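import Summits.QuantumFields.YangMills.Theorems.UnitScaleTiltProp7OneFormGradientSup
import Summits.QuantumFields.YangMills.Theorems.UnitScaleTiltProp7SectET3CurvedPropagatorsT3
import HarnessLib

/-!
# Route `UnitScaleTilt`, crux K1 «MinimiserStabilityRegPr» (stmt-QuantumFields-19200), EX row `norm_G`, ★p1 g27 CHAIR WORD №24 road **N5: THE `∇` OF THE (115) SPACE IS THE
# COMPONENTWISE `D_{U₀}` — the dictionary `nabla115 η (bgOfCfg U₀) ↔ covGrad (adBg U₀) ↔ DL2 ∘ toL2S ∘ formComp ↔ covGradT`, and the (∇) letters of ✓p767711 (OF-GRAD) in the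
# two currencies its consumers want** (lit ✓`B11Eq117ReadLettersBridge.norm_nabla115_readFun_le_of_global`'s `hDT` = the W-level `covGrad`; lit ✓`B11Eq117TransformationNormComp`'s
# (115) norm = the 𝔸-level `nabla115`; px19 g13 LOCATE-NORMG-ALGEBRA §2(iii), 19200 evidence #46).

Cell `ym3-torus` (HUMAN RULING D-0037; rung R3 = SU(2) YM₃ on T³ — NOT d = 4, NOT infinite volume, NOT a mass gap, NOT Clay).  Width seat `ym3-torus-px5` (gen 13).
THEOREMS ONLY (0 `def`, 0 `sorry`, default heartbeats); `--supports stmt-QuantumFields-19200 --as helper`; count-neutral.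

WHAT IS PROVED (ns `Summit.QuantumFields.YangMills.Theorems.Prop7OneFormGradientSupNabla`).
* §1 DICTIONARY (identities, no estimate): `frobEquiv_equiv_toL2` (`frobEquiv ((toL2 X)(q)) = X(bondEquiv⁻¹ q)`); ★`frobEquiv_covGrad_adBg_eq_nabla115` — for ANY vector field `u`,
  `frobEquiv (covGrad ((η:ℂ))⁻¹ (adBg U₀) (equiv u) (p, ν)) = nabla115 η (bgOfCfg U₀) (frobEquiv ∘ equiv u) (p, ν)` (lit `nabla115_apply`∕`covGrad_apply` + ✓`frobEquiv_adW`);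
  ★`covGrad_adBg_equiv_toL2_eq` (`covGrad ((η:ℂ))⁻¹ (adBg U₀) (equiv (toL2 X)) (p, ν) = equiv (D_{U₀}(toL2S X_ν)) p`, `rfl`); ★★`nabla115_bgOfCfg_eq_covGradT`
  (`nabla115 η (bgOfCfg U₀) (X ∘ bondEquiv⁻¹) (bondEquiv ⟨x, μ⟩, ν) = covGradT η (bgUnits U₀) X μ ν x` — [Balaban1985BackgroundPropagators] (3.3) = [Balaban1985Variational] (19) at the member).
* §2 THE (∇) LETTERS of (OF-GRAD) ✓`norm_equiv_DL2_formComp_le_of_letters`∕✓`norm_covGradT_le_of_letters` read through §1: ★★`norm_covGrad_adBg_equiv_toL2_le_of_letters` (W-level, every `(p, ν)`);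
  ★★★`norm_nabla115_bgOfCfg_le_of_letters` (the Pi sup norm `‖nabla115 (eta F n K) (bgOfCfg F K U₀) (X ∘ (bondEquiv F K).symm)‖ ≤ B`); `norm_nabla115_bgOfCfg_le_of_letters'` (the same
  with `η` spelled `((F.L:ℝ)⁻¹)^(K−n)` as the EX face does).
HYP-SAT (★★OWNER RULING №42): §1 none; §2 = (OF-GRAD)'s displayed letters (`RegPr`, `0 < ε₀ ≤ 1`, the one-form equation, `‖X‖_∞ ≤ s`, `‖Y‖_∞ ≤ M_Y`, (X)(D)(Q) bond rows, `hroom`, `hsmall`).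
HONEST SCOPE.  Dictionary + readback; nothing of N1∕N4∕N6–N8, `norm_G`, the 8 EX rows, `hThm2S`, EX or the crux is proved here; the Yang–Mills mass gap is NOT proved.

References: T. Bałaban, CMP **99** (1985) 389–434 [Balaban1985BackgroundPropagators] ((3.3) p.391, Thm 3.1 (3.42) p.397); CMP **102** (1985) 277–309 [Balaban1985Variational]
((19) p.281, (115)–(117) pp.294–295).
-/

set_option autoImplicit false

noncomputable section

open scoped BigOperators Matrix.Norms.L2Operator InnerProductSpace ComplexConjugate

namespace Summit.QuantumFields.YangMills.Theorems.Prop7OneFormGradientSupNabla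

open Literature.MathematicalPhysics.QuantumFieldTheory.Balaban1983to89
open Literature.MathematicalPhysics.QuantumFieldTheory.Balaban1983to89.T3ContinuumYM3Torus
open Literature.MathematicalPhysics.QuantumFieldTheory.Balaban1983to89.T3PrintedRegularMinimiser (RegPr)
open T3SectALandauChart (formComp covGradT bgUnits covDerivFwdT eta eta_pos)
open B4Sect5Torus (TSite)
open B9SectCLatticeCarrier (Bond)
open B9Eq33CovDerivVector (covGrad covGrad_apply)
open B11Eq111FrakG (nabla115 nabla115_apply)
open B9Eq311L2Pairing (WL2)
open B11Eq103H1Complex (SiteL2K BondL2K)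
open Summit.QuantumFields.YangMills.Theorems.Prop7SectET3Transport (periodsT3 siteEquiv bondEquiv bgOfCfg)
open Summit.QuantumFields.YangMills.Theorems.Prop7SectET3HilbertLetters (W₂ frobEquiv adBg adW frobEquiv_adW toL2 toL2S DL2 DstarL2 covLapSite toL2_apply toL2S_apply toL2_symm_apply)
open Summit.QuantumFields.YangMills.Theorems.Prop7SectET3WilsonHessian (DeltaEta)
open Summit.QuantumFields.YangMills.Theorems.Prop7SectET3GaugeProjector (RS)
open Summit.QuantumFields.YangMills.Theorems.Prop7SectET3CurvedPropagators (Qk laplaceA)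
open Summit.QuantumFields.YangMills.Theorems.Prop7RieszTauFrobNorm (norm_frobEquiv_le)
open Summit.QuantumFields.YangMills.Theorems.Prop7LandauDict (DL2_toL2S_eq_covDerivFwdT)
open Summit.QuantumFields.YangMills.Theorems.Prop7CurvedMemberLocalGradient (exists_curved_localGradient)
open Summit.QuantumFields.YangMills.Theorems.AxialGaugeChartGlue (norm_bgOfCfg_axialT_sub_le)
open Summit.QuantumFields.YangMills.Theorems.Prop7OneFormGradientSup (norm_equiv_DL2_formComp_le_of_letters norm_covGradT_le_of_letters)

variable (F : T3Family) {n K : ℕ} (h : n ≤ K) (c₀ cB : ℝ) [Fact (0 < c₀)] [Fact (0 < cB)] (a : ℝ)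
  (Δx : GaugeField (F.P K) 0 (Matrix.specialUnitaryGroup (Fin 2) ℂ) → (BondL2K ℂ 3 (periodsT3 F K) c₀ W₂ →ₗ[ℂ] BondL2K ℂ 3 (periodsT3 F K) c₀ W₂))
  (U₀ : GaugeField (F.P K) 0 (Matrix.specialUnitaryGroup (Fin 2) ℂ))
  {ε₀ : ℝ} (hε₀ : 0 < ε₀) (hε1 : ε₀ ≤ 1) (hreg : RegPr F n K ε₀ U₀)

/-! ## §1 The dictionary -/

omit [Fact (0 < c₀)] [Fact (0 < cB)] in
/-- `frobEquiv ((toL2 X)(q)) = X (bondEquiv⁻¹ q)` — the route's bond matrix at the lit bond. [cite: Balaban1985BackgroundPropagators, (3.11) p.392] -/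
theorem frobEquiv_equiv_toL2 (X : PBond (F.P K) 0 → Matrix (Fin 2) (Fin 2) ℂ) (q : Bond 3 (periodsT3 F K)) :
    frobEquiv (WL2.equiv ℂ (fun _ : Bond 3 (periodsT3 F K) => c₀) W₂ (toL2 F K c₀ X) q) = X ((bondEquiv F K).symm q) := by
  rw [toL2_apply, LinearEquiv.apply_symm_apply]

omit [Fact (0 < c₀)] [Fact (0 < cB)] in
/-- ★ **THE W-LEVEL `∇` IS THE (115) `∇` READ THROUGH `frobEquiv`**: for ANY vector field `u`, `frobEquiv ((covGrad ((η:ℂ))⁻¹ (adBg U₀) (equiv u)) (p, ν)) = (nabla115 η (bgOfCfg U₀) (frobEquiv ∘ equiv u)) (p, ν)`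
(`adBg U₀ p = Ad(U₀(p))` conjugated by `frobEquiv`, ✓`frobEquiv_adW`). [cite: Balaban1985BackgroundPropagators, (3.3) p.391] -/
theorem frobEquiv_covGrad_adBg_eq_nabla115 (u : BondL2K ℂ 3 (periodsT3 F K) c₀ W₂) (p : Bond 3 (periodsT3 F K)) (ν : Fin 3) :
    frobEquiv (covGrad ((((eta F n K : ℝ) : ℂ))⁻¹) (adBg F K U₀) (WL2.equiv ℂ (fun _ : Bond 3 (periodsT3 F K) => c₀) W₂ u) (p, ν))
      = nabla115 (eta F n K) (bgOfCfg F K U₀) (fun q => frobEquiv (WL2.equiv ℂ (fun _ : Bond 3 (periodsT3 F K) => c₀) W₂ u q)) (p, ν) := by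
  rw [nabla115_apply, covGrad_apply, map_smul, map_sub]
  congr 2
  exact frobEquiv_adW (bgOfCfg F K U₀ p) _

omit [Fact (0 < cB)] in
/-- ★ **`covGrad (adBg U₀)` OF A ONE-FORM = `D_{U₀}` OF ITS COMPONENTS**: `(covGrad ((η:ℂ))⁻¹ (adBg U₀) (equiv (toL2 X))) (p, ν) = (D_{U₀}(toL2S X_ν))(p)` — definitionally
(`DL2 = covDerivL2K … (adBg U₀)`, lit `covGrad_eq_covDeriv_comp`, `toL2_apply`∕`toL2S_apply` are `rfl`). [cite: Balaban1985BackgroundPropagators, (3.3) p.391] -/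
theorem covGrad_adBg_equiv_toL2_eq (X : PBond (F.P K) 0 → Matrix (Fin 2) (Fin 2) ℂ) (p : Bond 3 (periodsT3 F K)) (ν : Fin 3) :
    covGrad ((((eta F n K : ℝ) : ℂ))⁻¹) (adBg F K U₀) (WL2.equiv ℂ (fun _ : Bond 3 (periodsT3 F K) => c₀) W₂ (toL2 F K c₀ X)) (p, ν)
      = WL2.equiv ℂ (fun _ : Bond 3 (periodsT3 F K) => c₀) W₂ (DL2 F n K c₀ U₀ (toL2S F K c₀ (formComp X ν))) p := rfl

include c₀ in
omit [Fact (0 < cB)] in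
/-- ★★ **THE (115) `∇` AT THE MEMBER IS THE ROUTE's COVARIANT GRADIENT**: `(nabla115 η (bgOfCfg U₀) (X ∘ bondEquiv⁻¹)) (bondEquiv ⟨x, μ⟩, ν) = covGradT η (bgUnits U₀) X μ ν x`
([Balaban1985BackgroundPropagators] (3.3) = [Balaban1985Variational] (19); §1 + ✓`DL2_toL2S_eq_covDerivFwdT`). [cite: Balaban1985BackgroundPropagators, (3.3) p.391; Balaban1985Variational, (19) p.281] -/
theorem nabla115_bgOfCfg_eq_covGradT (X : PBond (F.P K) 0 → Matrix (Fin 2) (Fin 2) ℂ) (x : Site (F.P K) 0) (μ ν : Fin 3) :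
    nabla115 (eta F n K) (bgOfCfg F K U₀) (fun q => X ((bondEquiv F K).symm q)) (bondEquiv F K ⟨x, μ⟩, ν)
      = covGradT (eta F n K) (bgUnits F K U₀) X μ ν x := by
  have hfun : (fun q => X ((bondEquiv F K).symm q))
      = fun q => frobEquiv (WL2.equiv ℂ (fun _ : Bond 3 (periodsT3 F K) => c₀) W₂ (toL2 F K c₀ X) q) :=
    funext fun q => (frobEquiv_equiv_toL2 F c₀ X q).symm
  have hroute : covGradT (eta F n K) (bgUnits F K U₀) X μ ν x = (toL2 F K c₀).symm (DL2 F n K c₀ U₀ (toL2S F K c₀ (formComp X ν))) ⟨x, μ⟩ := by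
    rw [DL2_toL2S_eq_covDerivFwdT]; rfl
  rw [hfun, ← frobEquiv_covGrad_adBg_eq_nabla115 F c₀ U₀, covGrad_adBg_equiv_toL2_eq, hroute, toL2_symm_apply]

/-! ## §2 The (∇) letters of (OF-GRAD) in the two currencies -/

include hε₀ hε1 hreg in
/-- ★★ **THE W-LEVEL (∇) LETTER** (the `hDT` currency of lit ✓`norm_nabla115_readFun_le_of_global`): for `Δ_a(U₀)(toL2 X) = toL2 Y` with (OF-GRAD)'s letters, at EVERY lit bond `p`
and component `ν`, `‖(covGrad ((η:ℂ))⁻¹ (adBg U₀) (equiv (toL2 X))) (p, ν)‖ ≤ 2·(C_g·(√2 s·c(ε₀) + √2(32ε₀ s + M_X + M_D + M_Q + M_Y)) + 2√2·48ε₀·√2 s)`.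
[cite: Balaban1985BackgroundPropagators, (3.3) p.391, Thm 3.1 (3.42) p.397; Balaban1985Variational, (19) p.281] -/
theorem norm_covGrad_adBg_equiv_toL2_le_of_letters (X Y : PBond (F.P K) 0 → Matrix (Fin 2) (Fin 2) ℂ)
    (hXY : laplaceA F n K h c₀ cB a Δx U₀ (toL2 F K c₀ X) = toL2 F K c₀ Y)
    {s MY MX MD MQ : ℝ} (hs : 0 ≤ s) (hMY : 0 ≤ MY) (hMX : 0 ≤ MX) (hMD : 0 ≤ MD) (hMQ : 0 ≤ MQ)
    (hX : ∀ b, ‖X b‖ ≤ s) (hY : ∀ b, ‖Y b‖ ≤ MY)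
    (hXs : ∀ b : PBond (F.P K) 0, ‖(toL2 F K c₀).symm ((Δx U₀ - (DeltaEta F n K c₀ U₀ : BondL2K ℂ 3 (periodsT3 F K) c₀ W₂ →ₗ[ℂ] BondL2K ℂ 3 (periodsT3 F K) c₀ W₂)) (toL2 F K c₀ X)) b‖ ≤ MX)
    (hD : ∀ b : PBond (F.P K) 0, ‖(toL2 F K c₀).symm (DL2 F n K c₀ U₀ (DstarL2 F n K c₀ U₀ (toL2 F K c₀ X) - RS F n K h c₀ cB U₀ (DstarL2 F n K c₀ U₀ (toL2 F K c₀ X)))) b‖ ≤ MD)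
    (hQ : ∀ b : PBond (F.P K) 0, ‖(toL2 F K c₀).symm (LinearMap.adjoint (Qk F n K h c₀ cB U₀) (((a : ℝ) : ℂ) • Qk F n K h c₀ cB U₀ (toL2 F K c₀ X))) b‖ ≤ MQ)
    (hroom : 2 * (12 * F.L ^ (K - n) + 5) ≤ (F.P K).sitesPerDir 0)
    (hsmall : exists_curved_localGradient.choose * ((48 * ε₀) * (6 * Real.sqrt 2 * Real.sqrt 10 + 6 * Real.sqrt 2)) ≤ 1 / 2)
    (p : Bond 3 (periodsT3 F K)) (ν : Fin 3) :
    ‖covGrad ((((eta F n K : ℝ) : ℂ))⁻¹) (adBg F K U₀) (WL2.equiv ℂ (fun _ : Bond 3 (periodsT3 F K) => c₀) W₂ (toL2 F K c₀ X)) (p, ν)‖ ≤ 2 * (exists_curved_localGradient.choose * ((Real.sqrt 2 * s) * (2 + 2 * Real.sqrt 2 * (4 * ε₀ * (3 + 2457 * norm_bgOfCfg_axialT_sub_le.choose)) + (24 * Real.sqrt 10 + 48) * (48 * ε₀) ^ 2) + (Real.sqrt 2 * (32 * ε₀ * s + MX + MD + MQ + MY))) + 2 * Real.sqrt 2 * (48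 * ε₀) * (Real.sqrt 2 * s)) := by
  rw [covGrad_adBg_equiv_toL2_eq]
  exact norm_equiv_DL2_formComp_le_of_letters F h c₀ cB a Δx U₀ hε₀ hε1 hreg X Y hXY hs hMY hMX hMD hMQ hX hY hXs hD hQ hroom hsmall ν p

include hε₀ hε1 hreg in
/-- ★★★ **THE (115)-LEVEL (∇) LETTER IN THE SUP NORM**: `‖nabla115 (eta F n K) (bgOfCfg F K U₀) (X ∘ bondEquiv⁻¹)‖ ≤ B` (the Pi sup norm over `Bond × Fin 3` of the operator norms — the `∇`-half
of print's `|·|₍₁₎` at a member, where all (115) weights are `1`). [cite: Balaban1985Variational, (19) p.281, (115)–(117) pp.294–295; Balaban1985BackgroundPropagators, Thm 3.1 (3.42) p.397] -/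
theorem norm_nabla115_bgOfCfg_le_of_letters (X Y : PBond (F.P K) 0 → Matrix (Fin 2) (Fin 2) ℂ)
    (hXY : laplaceA F n K h c₀ cB a Δx U₀ (toL2 F K c₀ X) = toL2 F K c₀ Y)
    {s MY MX MD MQ : ℝ} (hs : 0 ≤ s) (hMY : 0 ≤ MY) (hMX : 0 ≤ MX) (hMD : 0 ≤ MD) (hMQ : 0 ≤ MQ)
    (hX : ∀ b, ‖X b‖ ≤ s) (hY : ∀ b, ‖Y b‖ ≤ MY)
    (hXs : ∀ b : PBond (F.P K) 0, ‖(toL2 F K c₀).symm ((Δx U₀ - (DeltaEta F n K c₀ U₀ : BondL2K ℂ 3 (periodsT3 F K) c₀ W₂ →ₗ[ℂ] BondL2K ℂ 3 (periodsT3 F K) c₀ W₂)) (toL2 F K c₀ X)) b‖ ≤ MX)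
    (hD : ∀ b : PBond (F.P K) 0, ‖(toL2 F K c₀).symm (DL2 F n K c₀ U₀ (DstarL2 F n K c₀ U₀ (toL2 F K c₀ X) - RS F n K h c₀ cB U₀ (DstarL2 F n K c₀ U₀ (toL2 F K c₀ X)))) b‖ ≤ MD)
    (hQ : ∀ b : PBond (F.P K) 0, ‖(toL2 F K c₀).symm (LinearMap.adjoint (Qk F n K h c₀ cB U₀) (((a : ℝ) : ℂ) • Qk F n K h c₀ cB U₀ (toL2 F K c₀ X))) b‖ ≤ MQ)
    (hroom : 2 * (12 * F.L ^ (K - n) + 5) ≤ (F.P K).sitesPerDir 0)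
    (hsmall : exists_curved_localGradient.choose * ((48 * ε₀) * (6 * Real.sqrt 2 * Real.sqrt 10 + 6 * Real.sqrt 2)) ≤ 1 / 2) :
    ‖nabla115 (eta F n K) (bgOfCfg F K U₀) (fun q => X ((bondEquiv F K).symm q))‖ ≤ 2 * (exists_curved_localGradient.choose * ((Real.sqrt 2 * s) * (2 + 2 * Real.sqrt 2 * (4 * ε₀ * (3 + 2457 * norm_bgOfCfg_axialT_sub_le.choose)) + (24 * Real.sqrt 10 + 48) * (48 * ε₀) ^ 2) + (Real.sqrt 2 * (32 * ε₀ * s + MX + MD + MQ + MY))) + 2 * Real.sqrt 2 * (48 * ε₀) * (Real.sqrt 2 * s)) := by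
  have hCg0 : 0 ≤ exists_curved_localGradient.choose := exists_curved_localGradient.choose_spec.1
  obtain ⟨hC0, -⟩ := norm_bgOfCfg_axialT_sub_le.choose_spec
  have hB : 0 ≤ 2 * (exists_curved_localGradient.choose * ((Real.sqrt 2 * s) * (2 + 2 * Real.sqrt 2 * (4 * ε₀ * (3 + 2457 * norm_bgOfCfg_axialT_sub_le.choose)) + (24 * Real.sqrt 10 + 48) * (48 * ε₀) ^ 2) + (Real.sqrt 2 * (32 * ε₀ * s + MX + MD + MQ + MY))) + 2 * Real.sqrt 2 * (48 * ε₀) * (Real.sqrt 2 * s)) := by positivity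
  refine (pi_norm_le_iff_of_nonneg hB).2 fun qν => ?_
  obtain ⟨q, ν⟩ := qν
  obtain ⟨b, rfl⟩ := (bondEquiv F K).surjective q
  obtain ⟨x, μ⟩ := b
  rw [nabla115_bgOfCfg_eq_covGradT F c₀ U₀]
  exact norm_covGradT_le_of_letters F h c₀ cB a Δx U₀ hε₀ hε1 hreg X Y hXY hs hMY hMX hMD hMQ hX hY hXs hD hQ hroom hsmall μ ν x

include hε₀ hε1 hreg in
/-- The same letter with `η` spelled `((F.L:ℝ)⁻¹)^(K−n)` (the EX face's spelling of `nabla115`'s scale; `eta F n K` is that term by definition). [cite: Balaban1985Variational, (5) p.278, (115) p.294] -/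
theorem norm_nabla115_bgOfCfg_le_of_letters' (X Y : PBond (F.P K) 0 → Matrix (Fin 2) (Fin 2) ℂ)
    (hXY : laplaceA F n K h c₀ cB a Δx U₀ (toL2 F K c₀ X) = toL2 F K c₀ Y)
    {s MY MX MD MQ : ℝ} (hs : 0 ≤ s) (hMY : 0 ≤ MY) (hMX : 0 ≤ MX) (hMD : 0 ≤ MD) (hMQ : 0 ≤ MQ)
    (hX : ∀ b, ‖X b‖ ≤ s) (hY : ∀ b, ‖Y b‖ ≤ MY)
    (hXs : ∀ b : PBond (F.P K) 0, ‖(toL2 F K c₀).symm ((Δx U₀ - (DeltaEta F n K c₀ U₀ : BondL2K ℂ 3 (periodsT3 F K) c₀ W₂ →ₗ[ℂ] BondL2K ℂ 3 (periodsT3 F K) c₀ W₂)) (toL2 F K c₀ X)) b‖ ≤ MX)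
    (hD : ∀ b : PBond (F.P K) 0, ‖(toL2 F K c₀).symm (DL2 F n K c₀ U₀ (DstarL2 F n K c₀ U₀ (toL2 F K c₀ X) - RS F n K h c₀ cB U₀ (DstarL2 F n K c₀ U₀ (toL2 F K c₀ X)))) b‖ ≤ MD)
    (hQ : ∀ b : PBond (F.P K) 0, ‖(toL2 F K c₀).symm (LinearMap.adjoint (Qk F n K h c₀ cB U₀) (((a : ℝ) : ℂ) • Qk F n K h c₀ cB U₀ (toL2 F K c₀ X))) b‖ ≤ MQ)
    (hroom : 2 * (12 * F.L ^ (K - n) + 5) ≤ (F.P K).sitesPerDir 0)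
    (hsmall : exists_curved_localGradient.choose * ((48 * ε₀) * (6 * Real.sqrt 2 * Real.sqrt 10 + 6 * Real.sqrt 2)) ≤ 1 / 2) :
    ‖nabla115 (((F.L : ℝ)⁻¹) ^ (K - n)) (bgOfCfg F K U₀) (fun q => X ((bondEquiv F K).symm q))‖ ≤ 2 * (exists_curved_localGradient.choose * ((Real.sqrt 2 * s) * (2 + 2 * Real.sqrt 2 * (4 * ε₀ * (3 + 2457 * norm_bgOfCfg_axialT_sub_le.choose)) + (24 * Real.sqrt 10 + 48) * (48 * ε₀) ^ 2) + (Real.sqrt 2 * (32 * ε₀ * s + MX + MD + MQ + MY))) + 2 * Real.sqrt 2 * (48 * ε₀) * (Real.sqrt 2 * s)) :=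
  norm_nabla115_bgOfCfg_le_of_letters F h c₀ cB a Δx U₀ hε₀ hε1 hreg X Y hXY hs hMY hMX hMD hMQ hX hY hXs hD hQ hroom hsmall

end Summit.QuantumFields.YangMills.Theorems.Prop7OneFormGradientSupNabla

end
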